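import Summits.BirchSwinnertonDyer.Rank1Residual.P2.CongruentNumberPairsAtTwoUPlus
import Literature.NumberTheory.EllipticCurves.Tian2014.ClassSixFamilyDescentProofs
import HarnessLib

/-!
# Sub-lane «bsd-p2»: the `ρ`-FREE DOORS at `2`, file 2 — class `6`: DOOR B6 (`n = 2p₁⋯p_k ≡ 6 (mod 8)`,
# Monsky's even matrix, `Σ₂′` odd) and DOOR C6 (`BSD(E_{2n}, 2)` on Tian's 2014 class-`6` family,
# uniformly in `k`, no GZK, no Monsky) — keyed to U⁺; p2-lead T-92 / T-94 (T-92 PS), lit-1 recipe T1-M39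

HONEST FRAMING (sub-lane «bsd-p2», run/shared/lean/b2b/bsd-rank1-residual/p2/, verbatim in every
file): the target of record is the FULL Birch–Swinnerton-Dyer formula for EVERY analytic-rank `≤ 1`
`E/ℚ` at ALL primes INCLUDING `2`; the odd-prime class ledger is referee A's; the `2`-part is OPEN
(cells O1 = X5 ∖ CM and O12 = the CM corner) and under census by «bsd-p2». Census / instrument
output at `2` = EVIDENCE / conjecture items with held-out validation, NEVER a Literature fact;
certificates close PAIRS (one isogeny class, `p = 2`), never classes. This file asserts NO
arithmetic fact. WHAT IT DOES. Sequel of `P2/CongruentNumberPairsAtTwoUPlus.lean` (the hypothesis U⁺ =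
`hU`, spelled in tree currency as there: the `ρ`-FREE parity statement of Tian–Yuan–Zhang Thm 3.5 (2),
= the conclusion of p2-monsky-lit's W2 composition `W2.uPlus_genusField_of (hTYZ) (hGZK)`, discharged by
name when that file lands). Here the class `n ≡ 6 (mod 8)`, where Tian–Yuan–Zhang Thm 1.2 AS PRINTED
decides nothing at `ρ(n) ≥ 1` and no `ρ = 0` certificate exists in the tree for even `n` (lit-1 T1-M38:
`ρ(2n) = 1` on every computed member of Tian's family — census EVIDENCE):
* §1 DOOR B6 (`n = 2p₁⋯p_k`, distinct odd primes, `n ≡ 6 (mod 8)`): `hU`, `hGZK`, Monsky 1994 EVEN case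
  (`hMe`) + KERNEL-DECIDED inputs (Legendre tables `L`, `d2`, `dm1`; kernel count `2` of the table form of
  Monsky's even matrix, i.e. `s(n) = 1`, via `monskySelmerRankEven_eq_of_table`; `Σ₂′(n)` odd over
  `GenusField`, one `decide` through `odd_genusSum₂'_genusField_iff`) ⟹ `ord_{s=1} L(E_n, s) = 1`, rank
  `1`, `Ш(E_n)[2^∞] = 0`, `BSD(E_n, 2)`; `L′/(Ω·Reg) = 2^{2k−2}·L²` with `L` odd
  (`rankOneDatum_of_uPlus_six`), `#E_n(ℚ)_tor = 4` (p323719), `∏c_ℓ = 2^{2k+2}` (p324736: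
  `tamagawaProduct_congruentNumberCurve_two_mul_prod`) — nothing per-curve displayed, NO `ρ`;
* §2 DOOR C6 (Tian 2014 Thm 5.2 / Thm 1.3 class-`6` family `2p₀p₁⋯p_k`, `p₀ ≡ 3 (mod 4)`,
  `pᵢ ≡ 1 (mod 8)`, odd Legendre graph): `hU`, Tian 2014 Thm 1.3 (`h13`), Rédei–Reichardt (`hR`) ⟹
  `BSD(E_{2n}, 2)` uniformly in `k` — rank `1 = ord` and `#Ш` odd by lit-1's `thm13_two_mul_caseSix`,
  `Σ₂′(2n)` odd by `odd_genusSum₂'_two_mul_caseSix` (p330146), hence `𝓛` odd by `hU`; GZK-free bridge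
  `bsdp_iff_valuation_of_leadingLCoeff` (`2k = 0 + (2k+4) − 4`); NO GZK, NO Monsky matrix, nothing
  per-curve (lit-1's consumer recipe T1-M39 verbatim).
Until `W2.uPlus_genusField_of` is in the tree every theorem here is CONDITIONAL on `hU` (a hypothesis,
not a fact of the tree); the sub-lane's reach counts (p2-monsky-x PRE-ARM: DOOR B6 182 600 rows
`< 3·10⁶`, DOOR C6 87 853 ⊂ B6) are census EVIDENCE and not coverage. The `2`-part on class `6` is NOT
in print (Tian 2014 Rem. 1.4 excludes `p ∣ 2m`; TYZ Thm 1.2 at `ρ ≥ 1` leaves the parity of `𝓛` open);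
it is U⁺'s output. Per-pair / per-family statements in the OPEN cell `openO12`; they close no class.
Nothing booked; no mark moved. Unit `b2b-bsdres-p2-typer` GEN 5; NEW file.

References: [TianYuanZhang2017] Thm 1.2, Thm 3.5, §1 (1.1); [Tian2014] Thm 1.3, Lemma 5.1, Thm 5.2,
(5.1), Rem 1.4; [HeathBrown1994SelmerCongruentII] Appendix (Monsky) p. 41; [LiMa2008] Thm 0.4;
[SilvermanAEC2009] Thm X.4.2; [SilvermanATAEC1994] IV.9 Table 4.1; [Knapp1993] Lemma 4.20;
[Miller2011LMS] Def 1.1; HOME/p2/LEAD-OKS.md L1-65 / T-92 / T-94; HOME/p2/LIT-STATUS.md T1-M38 / T1-M39.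
-/

noncomputable section

open scoped Classical

open Matrix Finset WeierstrassCurve NumberField Literature.NumberTheory.EllipticCurves
  Literature.NumberTheory.EllipticCurves.Rank1Residual
  Literature.NumberTheory.EllipticCurves.Rank1Residual.Typed
  Literature.NumberTheory.EllipticCurves.HeathBrown1994
  Literature.NumberTheory.EllipticCurves.TianYuanZhang2017
  Literature.NumberTheory.EllipticCurves.Tian2014
  Literature.NumberTheory.QuadraticFields.RedeiReichardt

set_option autoImplicit false

namespace Summit.BirchSwinnertonDyer.Rank1Residual.P2

/-! ## §1 DOOR B6: `n = 2p₁⋯p_k ≡ 6 (mod 8)`, Monsky's EVEN matrix with kernel count `2`, `Σ₂′(n)` odd -/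

section DoorB6

variable {k : ℕ} (p : Fin k → ℕ)

/-- **TABLE ROUTE FOR THE SELMER RANK (even `n = 2p₁⋯p_k`)**: certified symbol tables `L`,
`d2 = [(2/pᵢ) ≠ 1]`, `dm1 = [(−1/pᵢ) ≠ 1]` and a COUNTED kernel of the table form of Monsky's even
matrix `( Aᵀ + D₂  D₋₁ ; D₂  A + D₂ )` (`#ker = 2^s`, by `decide`) give `s(n) = 2k − rank M = s` (the even
twin of `monskySelmerRankOdd_eq_of_table`; table matrix as in `det_monskyMatrixEven_of_table`).
[cite: HeathBrown1994SelmerCongruentII, Appendix (Monsky), typescript p. 41 L20–L36] -/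
theorem monskySelmerRankEven_eq_of_table (L : Fin k → Fin k → ZMod 2) (d2 dm1 : Fin k → ZMod 2)
    (hL : ∀ i j, addLegendreSym (p j) (p i) = L i j) (h2 : ∀ i, addLegendreSym 2 (p i) = d2 i)
    (hm1 : ∀ i, addLegendreSym (-1) (p i) = dm1 i) {s : ℕ}
    (hcard : Fintype.card {v : Fin k ⊕ Fin k → ZMod 2 // Matrix.fromBlocks
        ((Matrix.of (fun i j => if i = j then ∑ l ∈ Finset.univ.erase i, L i l else L i j))ᵀ +
          Matrix.diagonal d2) (Matrix.diagonal dm1) (Matrix.diagonal d2)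
        (Matrix.of (fun i j => if i = j then ∑ l ∈ Finset.univ.erase i, L i l else L i j) +
          Matrix.diagonal d2) *ᵥ v = 0} = 2 ^ s) :
    monskySelmerRankEven p = s := by
  have e : monskyMatrixEven p = Matrix.fromBlocks
      ((Matrix.of (fun i j => if i = j then ∑ l ∈ Finset.univ.erase i, L i l else L i j))ᵀ +
        Matrix.diagonal d2) (Matrix.diagonal dm1) (Matrix.diagonal d2)
      (Matrix.of (fun i j => if i = j then ∑ l ∈ Finset.univ.erase i, L i l else L i j) +
        Matrix.diagonal d2) := by
    simp only [monskyMatrixEven, legendreMatrix_eq_ofTable p L hL,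
      legendreDiagonal_eq_ofTable p 2 d2 h2, legendreDiagonal_eq_ofTable p (-1) dm1 hm1]
  have h := card_ker_mulVec_eq_sum (monskyMatrixEven p)
  rw [e, hcard] at h
  have hs : s = 2 * k - (monskyMatrixEven p).rank := by
    rw [e]; exact Nat.pow_right_injective le_rfl h
  rw [monskySelmerRankEven]
  exact hs.symm

/-- `k(n) = k`, `a(n) = 0` for `n = 2p₁⋯p_k` with distinct ODD primes: `2k(n) − 2 − a(n) = 2k − 2`.
[cite: TianYuanZhang2017, §1 (p0002 L63–L65: k(n), a(n))] -/
theorem twoExponent_two_mul_prod_eq (hp : ∀ i, (p i).Prime) (hodd : ∀ i, Odd (p i))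
    (hinj : Function.Injective p) : twoExponent (2 * ∏ i, p i) = 2 * (k : ℤ) - 2 := by
  have hprod : ∏ i, p i = ∏ q ∈ univ.image p, q := by
    rw [Finset.prod_image fun i _ j _ h => hinj h]
  have hpf : (∏ i, p i).primeFactors = univ.image p := by
    rw [hprod, Nat.primeFactors_prod]
    simpa using fun i => hp i
  have hn0 : (∏ i, p i) ≠ 0 := Finset.prod_ne_zero_iff.mpr fun i _ => (hp i).ne_zero
  have h2 : (2 : ℕ) ∉ univ.image p := by
    intro h
    obtain ⟨i, -, hi⟩ := Finset.mem_image.mp h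
    have := hodd i
    rw [hi] at this
    exact (Nat.not_odd_iff_even.mpr even_two) this
  have hpf2 : (2 * ∏ i, p i).primeFactors = insert 2 (univ.image p) := by
    rw [Nat.primeFactors_mul two_ne_zero hn0, Nat.Prime.primeFactors Nat.prime_two, hpf,
      Finset.insert_eq]
  have hk : oddPrimeFactorCount (2 * ∏ i, p i) = k := by
    rw [oddPrimeFactorCount, hpf2, Finset.filter_insert, if_neg (Nat.not_odd_iff_even.mpr even_two),
      Finset.filter_true_of_mem (by simpa using fun i => hodd i),
      Finset.card_image_of_injective _ hinj, Finset.card_univ, Fintype.card_fin]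
  have ha : oddIndicator (2 * ∏ i, p i) = 0 := by
    rw [oddIndicator, if_pos (even_two_mul _)]
  rw [twoExponent, hk, ha]
  push_cast
  ring

/-- `∏_ℓ c_ℓ(E_n) = 2^{2k+2}` for `n = 2p₁⋯p_k` with distinct ODD primes (lit-1's
`tamagawaProduct_congruentNumberCurve_of_even` on a product tuple: `c₂ = 4`, `c_{pᵢ} = 4`).
[cite: SilvermanATAEC1994, IV.9.4 Steps 6 and 7, Table 4.1 (PDF pp. 345–347)] -/
theorem tamagawaProduct_congruentNumberCurve_two_mul_prod (hp : ∀ i, (p i).Prime)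
    (hodd : ∀ i, Odd (p i)) (hinj : Function.Injective p) {n : ℕ} (hn : 2 * ∏ i, p i = n) :
    (congruentNumberCurve n).tamagawaProduct = 2 ^ (2 * k + 2) := by
  subst hn
  have hprod : ∏ i, p i = ∏ q ∈ univ.image p, q := by
    rw [Finset.prod_image fun i _ j _ h => hinj h]
  have hpf : (∏ i, p i).primeFactors = univ.image p := by
    rw [hprod, Nat.primeFactors_prod]
    simpa using fun i => hp i
  have hn0 : (∏ i, p i) ≠ 0 := Finset.prod_ne_zero_iff.mpr fun i _ => (hp i).ne_zero
  have h2 : (2 : ℕ) ∉ univ.image p := by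
    intro h
    obtain ⟨i, -, hi⟩ := Finset.mem_image.mp h
    have := hodd i
    rw [hi] at this
    exact (Nat.not_odd_iff_even.mpr even_two) this
  rw [tamagawaProduct_congruentNumberCurve_of_even (squarefree_two_mul_prod_of_injective p hp hodd hinj)
    (even_two_mul _), Nat.primeFactors_mul two_ne_zero hn0, Nat.Prime.primeFactors Nat.prime_two, hpf,
    ← Finset.insert_eq, Finset.erase_insert h2, Finset.card_image_of_injective _ hinj, Finset.card_univ,
    Fintype.card_fin]

/-- **DOOR B6 (`ρ`-FREE, class `6`).** `n = 2p₁⋯p_k` (distinct odd primes), `n ≡ 6 (mod 8)`; hypothesis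
U⁺ (`hU`); named facts `hGZK`, `hMe` (Monsky 1994, EVEN case); KERNEL-DECIDED inputs: `s(n) = 1` by the
even table route with a counted kernel (`hker`), `Σ₂′(n)` odd over `GenusField` (`hgen`, one `decide`
through `odd_genusSum₂'_genusField_iff`). THEN `ord_{s=1} L(E_n, s) = 1`, rank `1`, `Ш(E_n)[2^∞] = 0`,
`BSD(E_n, 2)`: `L′/(Ω·Reg) = 2^{2k−2}·L²` with `L` odd (`rankOneDatum_of_uPlus_six`), `#Sel₂ = 8`, `#E_n(ℚ)_tor = 4` (p323719),
`∏c_ℓ = 2^{2k+2}` (p324736) — nothing per-curve displayed, no `ρ`.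
[cite: TianYuanZhang2017, Thm. 1.2, Thm. 3.5 and §1 (1.1)]
[cite: HeathBrown1994SelmerCongruentII, Appendix (Monsky), typescript p. 41 L20–L36]
[cite: SilvermanAEC2009, Thm. X.4.2] [cite: Miller2011LMS, Def. 1.1 (arXiv:1010.2431 p. 3)] -/
theorem rankOne_sha_bsdp_two_congruentNumberCurve_of_uPlus_six
    (hU : ∀ (n : ℕ), Squarefree n → (n % 8 = 5 ∨ n % 8 = 6 ∨ n % 8 = 7) →
      ∃ L : ℤ, IsScriptL n L ∧
        ((n % 8 = 5 ∨ n % 8 = 7) → (2 : ℤ) ∣ L →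
          Even (genusSum₁ n fun d => genusClassNumber (GenusField d)) ∧
          Even (genusSum₂' n fun d => genusClassNumber (GenusField d))) ∧
        (n % 8 = 6 → (2 : ℤ) ∣ L → Even (genusSum₂' n fun d => genusClassNumber (GenusField d))))
    (hGZK : rank_eq_analyticRank_of_analyticRank_le_one) (hMe : monsky_card_selmerGroup_two_even)
    (hp : ∀ i, (p i).Prime) (hodd : ∀ i, Odd (p i)) (hinj : Function.Injective p)
    {n : ℕ} (hn : 2 * ∏ i, p i = n) (h8 : n % 8 = 6)
    (L : Fin k → Fin k → ZMod 2) (d2 dm1 : Fin k → ZMod 2)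
    (hL : ∀ i j, addLegendreSym (p j) (p i) = L i j) (h2 : ∀ i, addLegendreSym 2 (p i) = d2 i)
    (hm1 : ∀ i, addLegendreSym (-1) (p i) = dm1 i)
    (hker : Fintype.card {v : Fin k ⊕ Fin k → ZMod 2 // Matrix.fromBlocks
        ((Matrix.of (fun i j => if i = j then ∑ l ∈ Finset.univ.erase i, L i l else L i j))ᵀ +
          Matrix.diagonal d2) (Matrix.diagonal dm1) (Matrix.diagonal d2)
        (Matrix.of (fun i j => if i = j then ∑ l ∈ Finset.univ.erase i, L i l else L i j) +
          Matrix.diagonal d2) *ᵥ v = 0} = 2)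
    (hgen : Odd (genusSum₂' n fun d => genusClassNumber (GenusField d))) :
    (congruentNumberCurve n).analyticRank = 1 ∧ (congruentNumberCurve n).mordellWeilRank = 1 ∧
      AddCommGroup.primaryComponent (congruentNumberCurve n).sha 2 = ⊥ ∧
      BSDp (congruentNumberCurve n) 2 := by
  have hsq : Squarefree n := hn ▸ squarefree_two_mul_prod_of_injective p hp hodd hinj
  have hn0 : n ≠ 0 := hsq.ne_zero
  haveI := isElliptic_congruentNumberCurve hn0
  haveI : Fact (Nat.Prime 2) := ⟨Nat.prime_two⟩
  -- U⁺ + `Σ₂′` odd: `ord = 1`, `L′ = 2^e · 𝓛² · Ω · Reg` with `𝓛` odd — no `ρ`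
  obtain ⟨Lz, hLodd, hr1, hderiv⟩ := rankOneDatum_of_uPlus_six hU hsq h8 hgen
  have hx : deriv (congruentNumberCurve n).entireLFunction 1 =
      (((2 : ℚ) ^ twoExponent n * (Lz : ℚ) ^ 2 : ℚ) : ℂ) *
        ((congruentNumberCurve n).realPeriodRat : ℂ) * ((congruentNumberCurve n).regulator : ℂ) := by
    rw [hderiv]; push_cast; ring
  -- GZK: rank `1`; Monsky (even) + counted kernel: `#Sel₂ = 8`; hence `Ш[2^∞] = 0`
  obtain ⟨hrank, -⟩ := hGZK (congruentNumberCurve n) (le_of_eq hr1)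
  rw [hr1] at hrank
  have hs : monskySelmerRankEven p = 1 :=
    monskySelmerRankEven_eq_of_table p L d2 dm1 hL h2 hm1 (s := 1) (by rw [hker, pow_one])
  have hsel : Nat.card ((congruentNumberCurve n).selmerGroup 2) = 8 := by
    subst hn
    rw [hMe k p hp hodd hinj, hs]
    norm_num
  have hbot := primaryComponent_sha_two_eq_bot_of_card_selmerGroup_eq_eight hn0 hrank hsel
  refine ⟨hr1, hrank, hbot, ?_⟩
  rw [bsdp_two_iff_of_LDerivOverOmegaReg_of_sha_two_eq_bot_of_torsionOrder_eq_four
    (congruentNumberCurve n) hGZK hr1 hx hbot (torsionOrder_congruentNumberCurve hsq),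
    padicValRat_two_zpow_mul_sq hLodd, tamagawaProduct_congruentNumberCurve_two_mul_prod p hp hodd hinj hn,
    padicValNat.prime_pow, ← hn, twoExponent_two_mul_prod_eq p hp hodd hinj]
  push_cast
  omega

/-- **DOOR B6, closed form: `BSD(E_n, 2)`** for `n = 2p₁⋯p_k ≡ 6 (mod 8)` with even-Monsky kernel count
`2` and `Σ₂′(n)` odd, modulo `hU` (U⁺), `hGZK`, `hMe` and nothing else.
[cite: TianYuanZhang2017, Thm. 1.2, Thm. 3.5 and §1 (1.1)] [cite: Miller2011LMS, Def. 1.1 (arXiv:1010.2431 p. 3)] -/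
theorem bsdp_two_congruentNumberCurve_of_uPlus_six
    (hU : ∀ (n : ℕ), Squarefree n → (n % 8 = 5 ∨ n % 8 = 6 ∨ n % 8 = 7) →
      ∃ L : ℤ, IsScriptL n L ∧
        ((n % 8 = 5 ∨ n % 8 = 7) → (2 : ℤ) ∣ L →
          Even (genusSum₁ n fun d => genusClassNumber (GenusField d)) ∧
          Even (genusSum₂' n fun d => genusClassNumber (GenusField d))) ∧
        (n % 8 = 6 → (2 : ℤ) ∣ L → Even (genusSum₂' n fun d => genusClassNumber (GenusField d))))
    (hGZK : rank_eq_analyticRank_of_analyticRank_le_one) (hMe : monsky_card_selmerGroup_two_even)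
    (hp : ∀ i, (p i).Prime) (hodd : ∀ i, Odd (p i)) (hinj : Function.Injective p)
    {n : ℕ} (hn : 2 * ∏ i, p i = n) (h8 : n % 8 = 6)
    (L : Fin k → Fin k → ZMod 2) (d2 dm1 : Fin k → ZMod 2)
    (hL : ∀ i j, addLegendreSym (p j) (p i) = L i j) (h2 : ∀ i, addLegendreSym 2 (p i) = d2 i)
    (hm1 : ∀ i, addLegendreSym (-1) (p i) = dm1 i)
    (hker : Fintype.card {v : Fin k ⊕ Fin k → ZMod 2 // Matrix.fromBlocks
        ((Matrix.of (fun i j => if i = j then ∑ l ∈ Finset.univ.erase i, L i l else L i j))ᵀ +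
          Matrix.diagonal d2) (Matrix.diagonal dm1) (Matrix.diagonal d2)
        (Matrix.of (fun i j => if i = j then ∑ l ∈ Finset.univ.erase i, L i l else L i j) +
          Matrix.diagonal d2) *ᵥ v = 0} = 2)
    (hgen : Odd (genusSum₂' n fun d => genusClassNumber (GenusField d))) :
    BSDp (congruentNumberCurve n) 2 :=
  (rankOne_sha_bsdp_two_congruentNumberCurve_of_uPlus_six p hU hGZK hMe hp hodd hinj hn h8 L d2 dm1 hL
    h2 hm1 hker hgen).2.2.2

end DoorB6

/-! ## §2 DOOR C6: Tian's 2014 class-`6` family `2p₀p₁⋯p_k` — `BSD(E_{2n}, 2)` uniformly in `k`, no GZK, no Monsky -/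

section DoorC6

variable {k : ℕ} (p : Fin (k + 1) → ℕ)

/-- **DOOR C6 — `BSD(E_{2n}, 2)` ON TIAN'S CLASS-`6` FAMILY** (lit-1 recipe T1-M39). For `n = p₀p₁⋯p_k`
with distinct primes `p₀ ≡ 3 (mod 4)`, `pᵢ ≡ 1 (mod 8)` (`i ≥ 1`) and odd Legendre graph (`hG`: the kernel
of Monsky's `A` is `{0, 𝟙}`), and `m = 2n ≡ 6 (mod 8)`: Tian 2014 Thm 1.3 (displayed fact `h13`, with
Lemma 5.1 / Thm 5.2; condition (1.1) discharged modulo Rédei–Reichardt `hR`) gives rank `E_{2n}(ℚ) = 1 =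
ord_{s=1} L(E_{2n}, s)` and `#Ш(E_{2n})` finite and ODD (`thm13_two_mul_caseSix`); the printed second genus
sum `Σ₂′(2n)` is ODD (`odd_genusSum₂'_two_mul_caseSix`), so U⁺ (`hU`) makes `𝓛(2n)` ODD and
`L′(E_{2n},1) = 2^{2k}·𝓛²·Ω·Reg` (`twoExponent_two_mul_caseSix`); with `#E_{2n}(ℚ)_tor = 4` and
`∏c_ℓ(E_{2n}) = 2^{2k+4}` (lit-1's theorems) the GZK-free bridge `bsdp_iff_valuation_of_leadingLCoeff`
reads `2k = 0 + (2k + 4) − 4`: **`BSD(E_{2n}, 2)`**, uniformly in `k`, modulo exactly {U⁺, Tian 2014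
Thm 1.3, Rédei–Reichardt} — no Gross–Zagier–Kolyvagin, no Monsky matrix, nothing per-curve displayed.
The `2`-part on this family is NOT in print (Tian 2014 Rem. 1.4 excludes `p ∣ 2m`; TYZ Thm 1.2 at
`ρ(2n) = 1` leaves the parity of `𝓛` open: lit-1 T1-M38); it is U⁺'s output.
[cite: Tian2014, Thm. 1.3, Lemma 5.1, Thm. 5.2 (arXiv p. 2 L5–L15; p. 28 L2–L16, L40–L43)]
[cite: TianYuanZhang2017, Thm. 1.2 (chunk p0002 L121–L129), Thm. 3.5 (p0011 L94–L112) and §1 (1.1)]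
[cite: LiMa2008, Thm. 0.4] [cite: Miller2011LMS, Def. 1.1 (arXiv:1010.2431 p. 3)] -/
theorem bsdp_two_congruentNumberCurve_two_mul_caseSix
    (hU : ∀ (n : ℕ), Squarefree n → (n % 8 = 5 ∨ n % 8 = 6 ∨ n % 8 = 7) →
      ∃ L : ℤ, IsScriptL n L ∧
        ((n % 8 = 5 ∨ n % 8 = 7) → (2 : ℤ) ∣ L →
          Even (genusSum₁ n fun d => genusClassNumber (GenusField d)) ∧
          Even (genusSum₂' n fun d => genusClassNumber (GenusField d))) ∧
        (n % 8 = 6 → (2 : ℤ) ∣ L → Even (genusSum₂' n fun d => genusClassNumber (GenusField d))))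
    (h13 : thm13_rank_one_and_sha_odd) (hR : redeiReichardt_fourTwoCard_classGroup)
    (hp : ∀ i, (p i).Prime) (hinj : Function.Injective p) (h3 : p 0 % 4 = 3)
    (h1 : ∀ i, i ≠ 0 → p i % 8 = 1) (hG : ∀ v, legendreMatrix p *ᵥ v = 0 → v = 0 ∨ v = fun _ => 1)
    {n : ℕ} (hn : ∏ i, p i = n) :
    BSDp (congruentNumberCurve (2 * n)) 2 := by
  have hodd' : ∀ i, Odd (p i) := odd_of_caseSix p h3 h1
  have hsq : Squarefree (2 * n) := hn ▸ squarefree_two_mul_prod_of_injective p hp hodd' hinj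
  have h8 : (2 * n) % 8 = 6 := hn ▸ two_mul_prod_mod_eight_caseSix p h3 h1
  have hN0 : 0 < 2 * n := Nat.pos_of_ne_zero hsq.ne_zero
  haveI := isElliptic_congruentNumberCurve hsq.ne_zero
  haveI : Fact (Nat.Prime 2) := ⟨Nat.prime_two⟩
  -- Tian 2014 Thm 1.3 on the family: rank `1 = ord`, `Ш` finite and odd
  obtain ⟨hrank, hr1, hfin, hshaodd⟩ := thm13_two_mul_caseSix p h13 hR hp hinj h3 h1 hG hn
  haveI := hfin
  -- U⁺ + `Σ₂′(2n)` odd: `𝓛` odd; `L′ = 2^{2k} · 𝓛² · Ω · Reg`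
  obtain ⟨Lz, hLodd, hL⟩ := exists_odd_scriptL_of_uPlus_six hU hsq h8
    (odd_genusSum₂'_two_mul_caseSix p hR hp hinj h3 h1 hG hn)
  have hL0' : Lz ≠ 0 := fun h => by simp [h] at hLodd
  have hL0 : (Lz : ℚ) ≠ 0 := by exact_mod_cast hL0'
  have hexp : twoExponent (2 * n) = 2 * (k : ℤ) := hn ▸ twoExponent_two_mul_caseSix p hp hinj h3 h1
  have hlead : (congruentNumberCurve (2 * n)).leadingLCoeff =
      (((2 : ℚ) ^ (2 * (k : ℤ)) * (Lz : ℚ) ^ 2 : ℚ) : ℂ) *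
        ((congruentNumberCurve (2 * n)).realPeriodRat : ℂ) *
          ((congruentNumberCurve (2 * n)).regulator : ℂ) := by
    rw [leadingLCoeff_congruentNumberCurve_eq_of_isScriptL hN0 hr1 hL, hexp]; push_cast; ring
  have hx0 : (2 : ℚ) ^ (2 * (k : ℤ)) * (Lz : ℚ) ^ 2 ≠ 0 :=
    mul_ne_zero (zpow_ne_zero _ two_ne_zero) (pow_ne_zero _ hL0)
  rw [bsdp_iff_valuation_of_leadingLCoeff (congruentNumberCurve (2 * n)) 2 (hrank.trans hr1.symm) hx0
    hlead, padicValRat_two_zpow_mul_sq hLodd, padicValNat.eq_zero_of_not_dvd hshaodd.not_two_dvd_nat,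
    tamagawaProduct_congruentNumberCurve_two_mul_prod p hp hodd' hinj (by rw [hn]), padicValNat.prime_pow,
    torsionOrder_congruentNumberCurve hsq, show (4 : ℕ) = 2 ^ 2 by norm_num, padicValNat.prime_pow]
  push_cast
  ring

/-- **`BSD(E_{2n}, 2)` for EVERY member of Tian's class-`6` family, as a `∀`-statement** over the prime
tuples (same content as `bsdp_two_congruentNumberCurve_two_mul_caseSix`, curve written
`congruentNumberCurve (2 * ∏ pᵢ)`), modulo `hU`, `h13`, `hR`; no per-curve input.
[cite: Tian2014, Thm. 1.3 and Thm. 5.2 (arXiv p. 2 L5–L15; p. 28 L40–L43)]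
[cite: TianYuanZhang2017, Thm. 1.2 and Thm. 3.5] [cite: Miller2011LMS, Def. 1.1 (arXiv:1010.2431 p. 3)] -/
theorem forall_bsdp_two_congruentNumberCurve_two_mul_caseSix
    (hU : ∀ (n : ℕ), Squarefree n → (n % 8 = 5 ∨ n % 8 = 6 ∨ n % 8 = 7) →
      ∃ L : ℤ, IsScriptL n L ∧
        ((n % 8 = 5 ∨ n % 8 = 7) → (2 : ℤ) ∣ L →
          Even (genusSum₁ n fun d => genusClassNumber (GenusField d)) ∧
          Even (genusSum₂' n fun d => genusClassNumber (GenusField d))) ∧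
        (n % 8 = 6 → (2 : ℤ) ∣ L → Even (genusSum₂' n fun d => genusClassNumber (GenusField d))))
    (h13 : thm13_rank_one_and_sha_odd) (hR : redeiReichardt_fourTwoCard_classGroup) :
    ∀ (k : ℕ) (p : Fin (k + 1) → ℕ), (∀ i, (p i).Prime) → Function.Injective p → p 0 % 4 = 3 →
      (∀ i, i ≠ 0 → p i % 8 = 1) → (∀ v, legendreMatrix p *ᵥ v = 0 → v = 0 ∨ v = fun _ => 1) →
      BSDp (congruentNumberCurve (2 * ∏ i, p i)) 2 :=
  fun _ p hp hinj h3 h1 hG => bsdp_two_congruentNumberCurve_two_mul_caseSix p hU h13 hR hp hinj h3 h1 hG rfl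

end DoorC6

end Summit.BirchSwinnertonDyer.Rank1Residual.P2

end
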